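import Summits.QuantumFields.BalabanUV.T4Continuum.Spine.NE2.AdjointRepresentationKernel

/-!
# NE2 / ConstantTransporterLaplacian — THE TIER-B COVARIANT-LAPLACIAN PERTURBATION AT A CONSTANT TRANSPORTER IS THE ZERO OPERATOR IFF THE TRANSPORTER IS `1`;
# at the generation-8 witness towers it is NON-ZERO iff `X` is non-central (cell `pub-balaban-gaps`, seat ne2, generation 9; row NE2 of `HOME/BALABAN-GAPS.md`)

HONEST FRAMING.  Row NE2 (node U1a of the T⁴ uniqueness spine) is NOT PRINTED and NOT PROVED; class word WORK-bound; nothing of Bałaban's is asserted beyond print;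
ONE finite torus; NOT ℝ⁴, NOT infinite volume, NOT a mass gap, NOT Clay.  [folklore] finite-dimensional algebra about the TREE's model operators; no word changes.

WHAT IT SETTLES.  Generation 9's `AdjointRepresentationKernel` made «non-trivial adjoint transport at the witness towers» a kernel statement about the tier-B
transporter DATA (`Ad(u_k^{(k)}) ≠ 1` iff `X` non-central).  The tier-B perturbation of the END's operator is `tierBPert R P₃ P₄ k = covPertC R k + P₃ k + P₄ k`
(`NE2BalabanLayer`), whose first summand is the covariant-Laplacian perturbation `covPertC R k = Δ^{R_k} − Δ ⊗ 1` (`ColourCovariantLaplacian`).  Here: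
* §1 constant colour fields `cvec φ` on the 1-form carrier; `siteMul` of a constant transporter is `1 ⊗ A`; `(S_ν ⊗ A)·cvec φ = cvec (Aφ)`; the covariant difference
  `∇^A_ν` maps `cvec φ` to `cvec (c(A − 1)φ)` and the free difference kills it;
* §2 the quadratic form `v̄·(DᴴD)v = (Dv)‾·(Dv)`; hence **`covLapC_const_eq_lapC_iff`**: for a lattice factor `c ≠ 0` and `d ≥ 1`, `Δ^{A} = Δ ⊗ 1` (as OPERATORS) iff
  `A = 1` — no unitarity needed (if the operators agree, `Σ_ν ‖∇^A_ν cvec φ‖² = cvec φ‾·Δ cvec φ = 0`, so `(A − 1)φ = 0` for every `φ`);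
* §3 along the tower: **`covPertC_const_eq_zero_iff`** (`covPertC (const A) k = 0 ↔ A = 1`), and AT THE WITNESS TOWERS of generation 8 (`cTow f X`, whose level-`k`
  tier-B transporters are the constant `Ad(exp(f(k,k)X))`): **`covPertC_cTow_eq_zero_iff`** — the covariant-Laplacian perturbation at level `k` is the ZERO OPERATOR iff
  `X` is central (`0 < f(k,k) ≤ 1`, `‖X‖ < ln 2`, frame containing su(N)) — and **`covPertC_cTow_ne_zero`** for non-central `X`.
So at these witnesses the END's operator differs from the flat one in the covariant-Laplacian summand (a non-zero operator), while the (124)-remainder and `Δ′`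
summands vanish (`ComposedRemainderCoherentTowerNonTrivial.Erem_cTow_eq_zero`, `ConstantConnectionTower.Sfield_cTow`∕`Bfield_cTow`).  NOT CLAIMED: that the
FULL operator (with the composed-averaging summand) differs from the flat one; anything about Bałaban's minimiser.
Locator (shape only): [B9] (3.3) p. 390 (covariant derivative with `R(U)`).  0 sorry; axioms ⊆ {propext, Classical.choice, Quot.sound}.
-/

noncomputable section

open scoped BigOperators ComplexConjugate Matrix Matrix.Norms.L2Operator Kronecker ComplexOrder

namespace Summit.QuantumFields.BalabanUV.T4Continuum.NE2.ConstantTransporterLaplacian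

open Literature.MathematicalPhysics.QuantumFieldTheory.Balaban1983to89
open Literature.MathematicalPhysics.QuantumFieldTheory.Balaban1983to89.B5Prop11Plancherel (Tor fine shiftM fdiff unitVec)
open Literature.MathematicalPhysics.QuantumFieldTheory.Balaban1983to89.B5G183RateUnitTower (lev)
open Literature.MathematicalPhysics.QuantumFieldTheory.Balaban1983to89.B9AdOrthogonal (herm0)
open Summit.QuantumFields.BalabanUV.Beta.AdjointCarrierWiringEnd (CompFamily)
open Summit.QuantumFields.BalabanUV.T4Continuum
open Summit.QuantumFields.BalabanUV.T4Continuum.BalabanAveragedTowerUnit (idx)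
open Summit.QuantumFields.BalabanUV.T4Continuum.BlockMultiplication (siteMul siteMul_apply siteMul_one)
open Summit.QuantumFields.BalabanUV.T4Continuum.ColourCovariantLaplacian (covDc covLapC lapC covPertC)
open Summit.QuantumFields.BalabanUV.T4Continuum.NE2.AdjointFieldInstance (adRep)
open Summit.QuantumFields.BalabanUV.T4Continuum.NE2.ComposedRemainderGaugeTowerRegular (topAdT)
open Summit.QuantumFields.BalabanUV.T4Continuum.NE2.ComposedRemainderCoherentTower (liftU)
open Summit.QuantumFields.BalabanUV.T4Continuum.NE2.ConstantConnectionTower (cTow cTow_mem exp_smul_mem_unitaryGroup)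
open Summit.QuantumFields.BalabanUV.T4Continuum.NE2.AdjointRepresentationKernel (topAdT_cTow_eq_one_iff)

variable {d : ℕ}

/-! ## §1 Constant colour fields and constant transporters -/

section Const

variable (Nf : Fin d → ℕ) [hNf : ∀ μ, NeZero (Nf μ)] {o : Type} [Fintype o] [DecidableEq o]

/-- the CONSTANT colour field `(x, μ) ↦ φ` on the 1-form carrier. [folklore] -/
def cvec (φ : o → ℂ) : (Tor Nf × Fin d) × o → ℂ := fun p => φ p.2

omit hNf [Fintype o] [DecidableEq o] in
/-- unfolding. [folklore] -/
theorem cvec_apply (φ : o → ℂ) (p : (Tor Nf × Fin d) × o) : cvec Nf φ p = φ p.2 := rfl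

omit hNf [Fintype o] [DecidableEq o] in
/-- `cvec` is injective (the carrier is inhabited). [folklore] -/
theorem cvec_eq_zero_iff [NeZero d] (φ : o → ℂ) : cvec Nf φ = 0 ↔ φ = 0 := by
  refine ⟨fun h => funext fun a => ?_, fun h => by subst h; rfl⟩
  have := congrFun h (((fun _ => 0), (0 : Fin d)), a)
  exact this

omit hNf [Fintype o] [DecidableEq o] in
/-- `siteMul` of a CONSTANT transporter is `1 ⊗ A`. [folklore] -/
theorem siteMul_const (A : Matrix o o ℂ) : siteMul (fun _ : Tor Nf × Fin d => A) = (1 : Matrix (Tor Nf × Fin d) (Tor Nf × Fin d) ℂ) ⊗ₖ A := by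
  ext ⟨i, a⟩ ⟨j, b⟩
  rw [siteMul_apply, Matrix.kroneckerMap_apply, Matrix.one_apply]
  split_ifs <;> simp

omit [DecidableEq o] in
/-- `(S_ν ⊗ A)·cvec φ = cvec (Aφ)` — the shift permutes sites, a constant field does not notice. [folklore] -/
theorem kron_shiftM_mulVec_cvec (ν : Fin d) (A : Matrix o o ℂ) (φ : o → ℂ) : (shiftM Nf ν ⊗ₖ A) *ᵥ cvec Nf φ = cvec Nf (A *ᵥ φ) := by
  funext p
  rw [Matrix.mulVec, dotProduct, Fintype.sum_prod_type, Finset.sum_eq_single (p.1.1 + unitVec Nf ν, p.1.2)]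
  · rw [cvec_apply, Matrix.mulVec, dotProduct]
    refine Finset.sum_congr rfl fun b _ => ?_
    rw [Matrix.kroneckerMap_apply, cvec_apply, shiftM, if_pos rfl, one_mul]
  · intro j _ hj
    refine Finset.sum_eq_zero fun b _ => ?_
    rw [Matrix.kroneckerMap_apply, shiftM, if_neg hj, zero_mul, zero_mul]
  · intro h; exact absurd (Finset.mem_univ _) h

/-- the covariant difference with a constant transporter: `∇^A_ν = c·(S_ν ⊗ A − 1)`. [cite: Balaban1985BackgroundPropagators, (3.3) p.390 (shape)] [folklore] -/
theorem covDc_const (c : ℂ) (A : Matrix o o ℂ) (ν : Fin d) :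
    covDc Nf c (fun _ _ => A) ν = c • (shiftM Nf ν ⊗ₖ A - 1) := by
  rw [covDc, siteMul_const, ← Matrix.mul_kronecker_mul, Matrix.one_mul, Matrix.mul_one]

/-- `∇^A_ν cvec φ = cvec (c·(A − 1)φ)`. [folklore] -/
theorem covDc_const_mulVec_cvec (c : ℂ) (A : Matrix o o ℂ) (ν : Fin d) (φ : o → ℂ) :
    covDc Nf c (fun _ _ => A) ν *ᵥ cvec Nf φ = cvec Nf (c • ((A - 1) *ᵥ φ)) := by
  rw [covDc_const, Matrix.smul_mulVec, Matrix.sub_mulVec, Matrix.one_mulVec, kron_shiftM_mulVec_cvec, Matrix.sub_mulVec, Matrix.one_mulVec]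
  funext p
  simp only [Pi.smul_apply, Pi.sub_apply, cvec_apply, smul_eq_mul]

/-- the FREE difference (lifted) kills constant fields: `(∇_ν ⊗ 1)·cvec φ = 0`. [folklore] -/
theorem fdiff_kron_one_mulVec_cvec (c : ℂ) (ν : Fin d) (φ : o → ℂ) : (fdiff Nf c ν ⊗ₖ (1 : Matrix o o ℂ)) *ᵥ cvec Nf φ = 0 := by
  have h : fdiff Nf c ν ⊗ₖ (1 : Matrix o o ℂ) = c • (shiftM Nf ν ⊗ₖ (1 : Matrix o o ℂ) - 1) := by
    rw [fdiff, Matrix.smul_kronecker, KroneckerLift.sub_kronecker, Matrix.one_kronecker_one]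
  rw [h, Matrix.smul_mulVec, Matrix.sub_mulVec, Matrix.one_mulVec, kron_shiftM_mulVec_cvec, Matrix.one_mulVec, sub_self, smul_zero]

omit hNf [DecidableEq o] in
/-- a finite sum of matrices acts termwise. [folklore] -/
theorem finsetSum_mulVec {σ β : Type} [Fintype σ] (s : Finset β) (A : β → Matrix σ σ ℂ) (v : σ → ℂ) :
    (∑ i ∈ s, A i) *ᵥ v = ∑ i ∈ s, A i *ᵥ v := by
  classical
  induction s using Finset.induction_on with
  | empty => rw [Finset.sum_empty, Finset.sum_empty, Matrix.zero_mulVec]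
  | @insert a s ha ih => rw [Finset.sum_insert ha, Finset.sum_insert ha, Matrix.add_mulVec, ih]

/-- the free Laplacian (lifted) kills constant fields. [folklore] -/
theorem lapC_mulVec_cvec (c : ℂ) (φ : o → ℂ) : lapC Nf c *ᵥ cvec Nf φ = (0 : (Tor Nf × Fin d) × o → ℂ) := by
  rw [lapC, finsetSum_mulVec]
  exact Finset.sum_eq_zero fun ν _ => by rw [← Matrix.mulVec_mulVec, fdiff_kron_one_mulVec_cvec, Matrix.mulVec_zero]

end Const

/-! ## §2 The quadratic form and the operator statement `Δ^A = Δ ⊗ 1 ↔ A = 1` -/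

section Quad

variable (Nf : Fin d → ℕ) [hNf : ∀ μ, NeZero (Nf μ)] {o : Type} [Fintype o] [DecidableEq o]

omit hNf [DecidableEq o] in
/-- `v̄·((DᴴD)v) = (Dv)‾·(Dv)`. [folklore] -/
theorem star_dotProduct_conjTranspose_mul_self_mulVec {σ : Type} [Fintype σ] (D : Matrix σ σ ℂ) (v : σ → ℂ) :
    star v ⬝ᵥ ((Dᴴ * D) *ᵥ v) = star (D *ᵥ v) ⬝ᵥ (D *ᵥ v) := by
  rw [← Matrix.mulVec_mulVec, Matrix.dotProduct_mulVec, Matrix.vecMul_conjTranspose, star_star]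

/-- the quadratic form of the covariant Laplacian on a constant field is the sum of the squared covariant differences. [folklore] -/
theorem star_dotProduct_covLapC_mulVec (c : ℂ) (R : Fin d → (Tor Nf × Fin d → Matrix o o ℂ)) (v : (Tor Nf × Fin d) × o → ℂ) :
    star v ⬝ᵥ (covLapC Nf c R *ᵥ v) = ∑ ν, star (covDc Nf c R ν *ᵥ v) ⬝ᵥ (covDc Nf c R ν *ᵥ v) := by
  rw [covLapC, finsetSum_mulVec, dotProduct_sum]
  exact Finset.sum_congr rfl fun ν _ => star_dotProduct_conjTranspose_mul_self_mulVec (covDc Nf c R ν) v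

/-- **`Δ^A = Δ ⊗ 1` AS OPERATORS IFF `A = 1`**, for a constant transporter `A`, lattice factor `c ≠ 0`, `d ≥ 1` (no unitarity needed). [folklore] -/
theorem covLapC_const_eq_lapC_iff [NeZero d] {c : ℂ} (hc : c ≠ 0) (A : Matrix o o ℂ) :
    covLapC Nf c (fun _ _ => A) = lapC Nf c ↔ A = 1 := by
  constructor
  · intro h
    -- every covariant difference of every constant field vanishes
    have hD : ∀ φ : o → ℂ, (A - 1) *ᵥ φ = 0 := by
      intro φ
      have hq : ∑ ν : Fin d, star (covDc Nf c (fun _ _ => A) ν *ᵥ cvec Nf φ) ⬝ᵥ (covDc Nf c (fun _ _ => A) ν *ᵥ cvec Nf φ) = 0 := by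
        rw [← star_dotProduct_covLapC_mulVec, h, lapC_mulVec_cvec, dotProduct_zero]
      have hν := (Finset.sum_eq_zero_iff_of_nonneg fun ν _ => dotProduct_star_self_nonneg _).mp hq (0 : Fin d) (Finset.mem_univ _)
      rw [dotProduct_star_self_eq_zero, covDc_const_mulVec_cvec, cvec_eq_zero_iff] at hν
      exact (smul_eq_zero.mp hν).resolve_left hc
    have hA1 : A - 1 = 0 := by
      ext a b
      have := congrFun (hD (Pi.single b 1)) a
      rwa [Matrix.mulVec_single_one, Pi.zero_apply] at this
    exact sub_eq_zero.mp hA1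
  · rintro rfl
    rw [covLapC, lapC]
    refine Finset.sum_congr rfl fun ν _ => ?_
    have h : covDc Nf c (fun (_ : Fin d) (_ : Tor Nf × Fin d) => (1 : Matrix o o ℂ)) ν = fdiff Nf c ν ⊗ₖ (1 : Matrix o o ℂ) := by
      rw [covDc_const, fdiff, Matrix.smul_kronecker, KroneckerLift.sub_kronecker, Matrix.one_kronecker_one]
    rw [h]

end Quad

/-! ## §3 Along the tower and at the witness towers of generation 8 -/

section Tower

variable (L : ℕ) [NeZero L] (M : Fin d → ℕ) [hM : ∀ μ, NeZero (M μ)] {o : Type} [Fintype o] [DecidableEq o]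

/-- **THE TIER-B COVARIANT-LAPLACIAN PERTURBATION OF A CONSTANT TRANSPORTER TOWER AT LEVEL `k` IS THE ZERO OPERATOR IFF THE TRANSPORTER IS `1`** (`d ≥ 1`). [folklore] -/
theorem covPertC_const_eq_zero_iff [NeZero d] (A : ℕ → Matrix o o ℂ) (k : ℕ) :
    covPertC L M (fun k _ _ => A k) k = 0 ↔ A k = 1 := by
  have hc : ((lev L k : ℕ) : ℂ) ≠ 0 := Nat.cast_ne_zero.mpr (NeZero.ne (lev L k))
  rw [covPertC, sub_eq_zero]
  exact covLapC_const_eq_lapC_iff (fine (lev L k) M) hc (A k)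

variable {n : Type} [Fintype n] [DecidableEq n] [Nonempty n] {ι : Type} [Fintype ι] [DecidableEq ι]
  {c : ℝ} {P : Submodule ℝ (Matrix n n ℂ)} {e : ι → Matrix n n ℂ} (hF : CompFamily c P e)

omit [NeZero L] hM [Nonempty n] in
/-- the tier-B transporters of a constant-per-level tower at its top level are the CONSTANT `Ad(exp(f(k,k)X))`. [folklore] -/
theorem topAdT_cTow_eq_const (f : ℕ → ℕ → ℝ) {X : Matrix n n ℂ} (hX : star X = -X) :
    topAdT L M hF (liftU L M (cTow L M f X) (cTow_mem L M f hX)) =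
      fun k _ _ => adRep hF ⟨NormedSpace.exp (((f k k : ℝ) : ℂ) • X), exp_smul_mem_unitaryGroup hX _⟩ := rfl

/-- **AT THE WITNESS TOWERS: the tier-B covariant-Laplacian perturbation at level `k` is the ZERO OPERATOR iff `X` is central** (`0 < f(k,k) ≤ 1`, `‖X‖ < ln 2`, frame
containing su(N), `d ≥ 1`). [folklore] -/
theorem covPertC_cTow_eq_zero_iff [NeZero d] (hP : herm0 n ≤ P) {f : ℕ → ℕ → ℝ} {X : Matrix n n ℂ} (hX : star X = -X) (hXs : ‖X‖ < Real.log 2) {k : ℕ}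
    (hf0 : 0 < f k k) (hf1 : f k k ≤ 1) :
    covPertC L M (topAdT L M hF (liftU L M (cTow L M f X) (cTow_mem L M f hX))) k = 0 ↔ X ∈ Set.range (Matrix.scalar n) := by
  rw [topAdT_cTow_eq_const L M hF f hX, covPertC_const_eq_zero_iff,
    ← topAdT_cTow_eq_one_iff hF L M hP hX hXs hf0 hf1 (0 : Fin d) (((fun _ => 0), (0 : Fin d)) : idx L M k)]
  rfl

/-- **… hence NON-ZERO for non-central `X`**: at the generation-8 witness towers the END's operator differs from the flat one in the covariant-Laplacian summand. [folklore] -/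
theorem covPertC_cTow_ne_zero [NeZero d] (hP : herm0 n ≤ P) {f : ℕ → ℕ → ℝ} {X : Matrix n n ℂ} (hX : star X = -X) (hXs : ‖X‖ < Real.log 2)
    (hXc : X ∉ Set.range (Matrix.scalar n)) {k : ℕ} (hf0 : 0 < f k k) (hf1 : f k k ≤ 1) :
    covPertC L M (topAdT L M hF (liftU L M (cTow L M f X) (cTow_mem L M f hX))) k ≠ 0 :=
  fun h => hXc ((covPertC_cTow_eq_zero_iff L M hF hP hX hXs hf0 hf1).mp h)

end Tower

end Summit.QuantumFields.BalabanUV.T4Continuum.NE2.ConstantTransporterLaplacian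

end
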